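import Summits.QuantumFields.YangMills.Theorems.UnitScaleTiltProp7TiledCubeMemberH7H8
import HarnessLib

/-!
# Route `UnitScaleTilt`, crux K1 «MinimiserStabilityRegPr» (stmt-QuantumFields-19200) — route-R E′ (A′), LANE II «DIVERGENCE RECOVERY AT CURVED `W`» (★★OWNER RULING №23),
# (B7) [I-5]∕[I-9] (a′) FILE 5 — **`h7 ⊕ h8` AT THE MEMBER, INSIDE FORM** (★p1 g19 NAMER WORD №15, 2026-08-29 11:54Z): the rows of ✓p715183 `knitA` ∕ ✓p715684
# `h7h8_core`∕`h7h8_member` restated with the fine covariant term kept as the INSIDE CHART ENERGY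
# `Gφ_in := c₀·Σ_{w ∈ box z R_f}Σ_μ 𝟙[w + e_μ ∈ box]·Σ_{jk}‖(Ad(V w μ)φ_Z(w+e_μ) − φ_Z w)_{jk}‖²` ((B8-member) (h1)'s `φ_Z`-letter, K-uniformly fed by the budget) instead of
# the global `‖D_W φ‖²` of the zero-extended `φ` (whose boundary-layer jumps cost `≈ 6R_f·N`, K-dependent).  The change is one line in stage A: (B9d)'s covariant sum in
# operator norm is bounded TERMWISE by the Frobenius sum (lit ✓`MatrixNorms.opNorm_sq_le_sum_norm_sq`) instead of by `‖D_Wφ‖²` through FILE 1's row (B); `hD` drops out.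
# ✓p715042 `currency_h7h8` applies verbatim (its `Gφ` atom is abstract): `h7 : Φt ≤ 8·(Gφ_in + e²Φ) + Nt`, `h8` unchanged.

Cell `ym3-torus` ∕ width seat `ym3-torus-px9` (gen 7, «width 9»).  THEOREMS ONLY (0 `def`, 0 `sorry`); `--supports stmt-QuantumFields-19200 --as helper`, count-neutral.
YM₃ on T³ is a ladder rung (R3), not d = 4, not the Clay problem; nothing here claims (B7), (REC), `hN06`, E′, EX or the gap.

WHAT IS PROVED (ns `…Theorems.Prop7TiledCubeMemberH7H8In`): ★★★ `knitA_in` · ★★★ `h7h8_core_in` · ★★★ `h7h8_member_in`.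
HONEST SCOPE.  Bookkeeping over landed rows; nothing of (B7)∕(REC)∕`hN06`∕the crux is asserted; rung R3, not Clay; YM gap NOT proved.

References: T. Bałaban, CMP 98 (1985) 17–51 [Balaban1985Averaging] ((20) p.21: operator vs Hilbert–Schmidt norm; pp.24–25); T. Bałaban, CMP 99 (1985) 389–434
[Balaban1985BackgroundPropagators] ((3.19) p.393, (3.100) p.413); T. Bałaban, CMP 99 (1985) 75–102 [Balaban1985RegularSpaces] ((1.3) p.77).
-/

set_option autoImplicit false

open scoped BigOperators Matrix.Norms.L2Operator

namespace Summit.QuantumFields.YangMills.Theorems.Prop7TiledCubeMemberH7H8In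

open Literature.MathematicalPhysics.QuantumFieldTheory.Balaban1983to89
open Literature.MathematicalPhysics.QuantumFieldTheory.Balaban1983to89.T3ContinuumYM3Torus
open Literature.MathematicalPhysics.QuantumFieldTheory.Balaban1983to89.T3PrintedRegularMinimiser (RegPr)
open Literature.MathematicalPhysics.QuantumFieldTheory.Balaban1983to89.B4Eq19LatticeOperators (Zd box unitVec mem_box)
open Literature.MathematicalPhysics.QuantumLattice (blockMap blockBase blockSites)
open B10Eq27TorusAxialLog (transl pull pull_apply holT unitsField toUField)
open B7Prop1Explicit (axialFn U1 e)
open B7Prop2Explicit (C0 c2')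
open B7Eq78Linearization (conjR QprimeIter zdBlocking)
open B8Eq119TwistedAxial (bgT)
open B9B8AveragingKernelZd (blockIter)
open T4TermwiseTorus (tlift)
open T3SectALandauChart (eta eta_pos bgUnits)
open B11Eq103H1Complex (SiteL2K BondL2K)
open Summit.QuantumFields.YangMills.Theorems.Prop7SectET3Transport (periodsT3)
open Summit.QuantumFields.YangMills.Theorems.Prop7SectET3HilbertLetters (W₂ toL2 toL2S DL2)
open Summit.QuantumFields.YangMills.Theorems.Prop7SPrint (basePt)
open Summit.QuantumFields.YangMills.Theorems.Prop7QprimeCombL2 (QprimeCombL2)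
open Summit.QuantumFields.YangMills.Theorems.Prop7LatticeTiledCube (sum_tiled_sq_le_plaq)
open Summit.QuantumFields.YangMills.Theorems.Prop7TiledCubeMemberRows (chart_mass_le eta_sq_sum_opNorm_sq_le_norm_sq)
open Summit.QuantumFields.YangMills.Theorems.Prop7CombVsAxialMeansMember (sum_sq_grad_conv_of_regPr)
open Summit.QuantumFields.YangMills.Theorems.Prop7TiledCubeMemberKnit (knit_arith blockIter_eq_blk tiled_eq_box_of succ_le_sitesPerDir_of knitB_arith weight_eq)
open Summit.QuantumFields.YangMills.Theorems.Prop7TiledCubeMemberH7H8 (sum_normSq_axialDiff_eq sum_C_src_le sum_C_tgt_le sum_C_normSq_combDiff_eq)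

variable (F : T3Family) (n K : ℕ) (c₀ : ℝ) [Fact (0 < c₀)]

/-! ## §1 Stage A, inside form -/

/-- ★★★ **STAGE A, INSIDE FORM (NAMER WORD №15)** — as ✓`knitA` but with the fine covariant term kept as the INSIDE chart energy `Gφ_in := c₀Σ_{w∈Q}Σ_μ𝟙[w+e_μ∈Q]·hs(Ad(V w μ)φ_Z(w+e_μ) − φ_Z w)` ((B8-member) (h1)'s letter) instead of the global `‖D_Wφ‖²` (which carries the K-dependent boundary-layer jumps of the zero-extended `φ`); no `hD` needed. Original form: for any chart centre `c`, a box `box z R_f` (`2R_f + 1 ≤ N₀`) that is exactly the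
tiled cube of the blocks `b ∈ lo + [0,m]^d` (`hbox`), the box pull-back `V` of `W` with `PlaqSmall V (z−R_f) (z+R_f) α`, a member field `φ` with chart function `φ_Z`
(rows `hφZ`, `hD` of (B8-member)) normalised by (0) (`h0`):
`c₀Σ_{w ∈ box}hs(φ♭(c + w)) ≤ 8·Gφ_in + 32ℓ²(2dR_fα)²d‖φ‖² + 2c₀η²·(2ℓ^d·(2·(2·(m(m+1)∕2)·DIFF)))`, `DIFF` = (B9d)'s coarse double sum over the axial block means of `φ_Z`.
[cite: Balaban1985Averaging, pp.24-25; Balaban1985BackgroundPropagators, (3.100) p.413] -/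
theorem knitA_in (W : GaugeField (F.P K) 0 (Matrix.specialUnitaryGroup (Fin 2) ℂ))
    (c : Site (F.P K) 0) {z : Zd (F.P K).d} {Rf : ℤ} (hRN : 2 * Rf + 1 ≤ ((F.P K).sitesPerDir 0 : ℤ))
    (lo : Zd (F.P K).d) (m : ℕ)
    (hbox : Fintype.piFinset (fun i => Finset.Icc (((F.L ^ (K - n) : ℕ) : ℤ) * lo i) (((F.L ^ (K - n) : ℕ) : ℤ) * lo i + (((m + 1) * F.L ^ (K - n) - 1 : ℕ) : ℤ)))
      = box z Rf)
    (V : Zd (F.P K).d → Fin (F.P K).d → (Matrix (Fin 2) (Fin 2) ℂ)ˣ) (hV : ∀ w μ, V w μ = unitsField (toUField W) ⟨transl c w, μ⟩)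
    {α : ℝ} (hα : 0 ≤ α) (hP : B8Lemma1NonAbelian.PlaqSmall V (fun i => z i - Rf) (fun i => z i + Rf) α)
    (φ : SiteL2K ℂ 3 (periodsT3 F K) c₀ W₂) (φZ : Zd (F.P K).d → Matrix (Fin 2) (Fin 2) ℂ)
    (hφZ : ∀ w ∈ box z Rf, (toL2S F K c₀).symm φ (transl c w) = (eta F n K) • φZ w)
    (h0 : ∑ w ∈ box z Rf, conjR (axialFn V (fun i => z i - Rf) w) (φZ w) = 0) :
    c₀ * ∑ w ∈ box z Rf, ∑ j : Fin 2, ∑ k : Fin 2, ‖((toL2S F K c₀).symm φ (transl c w)) j k‖ ^ 2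
      ≤ 8 * (c₀ * ∑ w ∈ box z Rf, ∑ μ, (if w + unitVec μ ∈ box z Rf then
            ∑ j : Fin 2, ∑ k : Fin 2, ‖(conjR (V w μ) (φZ (w + unitVec μ)) - φZ w) j k‖ ^ 2 else 0))
        + 32 * ((F.L : ℝ) ^ (K - n)) ^ 2 * (2 * ((F.P K).d : ℝ) * Rf * α) ^ 2 * ((F.P K).d : ℝ) * ‖φ‖ ^ 2
        + 2 * (c₀ * (eta F n K) ^ 2) * (2 * (((F.L ^ (K - n)) ^ (F.P K).d : ℕ) : ℝ) *
          (2 * (2 * ((m : ℝ) * (m + 1) / 2) *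
              ∑ b ∈ Fintype.piFinset (fun i => Finset.Icc (lo i) (lo i + m)), ∑ μ,
                (if b + unitVec μ ∈ Fintype.piFinset (fun i => Finset.Icc (lo i) (lo i + m)) then
                  ‖((((F.L ^ (K - n)) ^ (F.P K).d : ℕ) : ℝ) : ℂ)⁻¹ • ∑ x' ∈ Fintype.piFinset (fun i => Finset.Icc (((F.L ^ (K - n) : ℕ) : ℤ) * (b + unitVec μ) i) (((F.L ^ (K - n) : ℕ) : ℤ) * (b + unitVec μ) i + ((F.L ^ (K - n) - 1 : ℕ) : ℤ))),
                      conjR (axialFn V (fun i => z i - Rf) x') (φZ x')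
                    - ((((F.L ^ (K - n)) ^ (F.P K).d : ℕ) : ℝ) : ℂ)⁻¹ • ∑ x' ∈ Fintype.piFinset (fun i => Finset.Icc (((F.L ^ (K - n) : ℕ) : ℤ) * b i) (((F.L ^ (K - n) : ℕ) : ℤ) * b i + ((F.L ^ (K - n) - 1 : ℕ) : ℤ))),
                      conjR (axialFn V (fun i => z i - Rf) x') (φZ x')‖ ^ 2
                else 0)))) := by
  classical
  have hc : 0 < c₀ := Fact.out
  have hL : 0 < F.L := by have := F.hL.2; omega
  have hLR : (0 : ℝ) < F.L := by exact_mod_cast hL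
  have hℓ : 1 ≤ F.L ^ (K - n) := Nat.one_le_pow _ _ hL
  -- the pull-back connection is unitary
  have hVu : ∀ w μ, V w μ ∈ B7Prop2Explicit.unitaryUnits (Matrix (Fin 2) (Fin 2) ℂ) := fun w μ => by
    rw [hV]; exact B10Eq27TorusAxialLog.unitsField_mem_unitaryUnits (toUField W) _
  have hsub : Fintype.piFinset (fun i => Finset.Icc (((F.L ^ (K - n) : ℕ) : ℤ) * lo i)
      (((F.L ^ (K - n) : ℕ) : ℤ) * lo i + (((m + 1) * F.L ^ (K - n) - 1 : ℕ) : ℤ))) ⊆ box z Rf := hbox.le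
  -- (B9d) on the tiled cube = the box
  have h9 := sum_tiled_sq_le_plaq (N := 2) hℓ lo m hα V hVu hP hsub φZ
  rw [hbox] at h9
  -- the overall mean vanishes by the normalisation (B8)(0)
  have hm : ‖((((box z Rf).card : ℝ)) : ℂ)⁻¹ • ∑ x ∈ box z Rf, conjR (axialFn V (fun i => z i - Rf) x) (φZ x)‖ ^ 2 = 0 := by
    rw [h0, smul_zero, norm_zero, zero_pow two_ne_zero]
  rw [hm, mul_zero, add_zero] at h9
  -- the member rows
  have hA := chart_mass_le F n K c₀ c φ φZ hφZ (box z Rf) (Finset.Subset.refl _)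
  have hB : c₀ * ∑ x ∈ box z Rf, ∑ μ, (if x + unitVec μ ∈ box z Rf then ‖conjR (V x μ) (φZ (x + unitVec μ)) - φZ x‖ ^ 2 else 0)
      ≤ (c₀ * ∑ w ∈ box z Rf, ∑ μ, (if w + unitVec μ ∈ box z Rf then
            ∑ j : Fin 2, ∑ k : Fin 2, ‖(conjR (V w μ) (φZ (w + unitVec μ)) - φZ w) j k‖ ^ 2 else 0)) :=
    mul_le_mul_of_nonneg_left (Finset.sum_le_sum fun w _ => Finset.sum_le_sum fun μ _ => by
      split_ifs
      · exact MatrixNorms.opNorm_sq_le_sum_norm_sq _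
      · exact le_rfl) hc.le
  have hC := eta_sq_sum_opNorm_sq_le_norm_sq F n K c₀ c hRN φ φZ hφZ (box z Rf) (Finset.Subset.refl _)
  -- scale facts: `η ℓ = 1`, `c = ℓ(ℓ−1)/2 ≤ ℓ²/2`
  have hηℓ : eta F n K * (F.L : ℝ) ^ (K - n) = 1 := by
    show ((F.L : ℝ)⁻¹) ^ (K - n) * (F.L : ℝ) ^ (K - n) = 1
    rw [← mul_pow, inv_mul_cancel₀ hLR.ne', one_pow]
  have hsq : ((F.L : ℝ) ^ (K - n)) ^ 2 * (eta F n K) ^ 2 = 1 := by rw [← mul_pow, mul_comm, hηℓ, one_pow]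
  have e1 : (((F.L ^ (K - n) - 1 : ℕ) : ℝ) + 1) = (F.L : ℝ) ^ (K - n) := by
    rw [Nat.cast_sub hℓ]; push_cast; ring
  have hcc2 : ((F.L ^ (K - n) - 1 : ℕ) : ℝ) * (((F.L ^ (K - n) - 1 : ℕ) : ℝ) + 1) / 2 ≤ ((F.L : ℝ) ^ (K - n)) ^ 2 / 2 := by
    rw [e1]
    have e2 : ((F.L ^ (K - n) - 1 : ℕ) : ℝ) ≤ (F.L : ℝ) ^ (K - n) := by linarith [e1]
    have h0' : (0 : ℝ) ≤ (F.L : ℝ) ^ (K - n) := by positivity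
    nlinarith [e2, h0']
  have hcc1 : ((F.L ^ (K - n) - 1 : ℕ) : ℝ) * (((F.L ^ (K - n) - 1 : ℕ) : ℝ) + 1) / 2 * (eta F n K) ^ 2 ≤ 1 / 2 := by
    have := mul_le_mul_of_nonneg_right hcc2 (sq_nonneg (eta F n K))
    have e3 : ((F.L : ℝ) ^ (K - n)) ^ 2 / 2 * (eta F n K) ^ 2 = 1 / 2 := by
      rw [div_mul_eq_mul_div, hsq]
    linarith [e3]
  have hCOV0 : 0 ≤ ∑ x ∈ box z Rf, ∑ μ, (if x + unitVec μ ∈ box z Rf then ‖conjR (V x μ) (φZ (x + unitVec μ)) - φZ x‖ ^ 2 else 0) :=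
    Finset.sum_nonneg fun x _ => Finset.sum_nonneg fun μ _ => by split_ifs <;> positivity
  have hS0 : 0 ≤ ∑ x ∈ box z Rf, ‖φZ x‖ ^ 2 := Finset.sum_nonneg fun x _ => by positivity
  have hd0 : (0 : ℝ) ≤ ((F.P K).d : ℝ) := Nat.cast_nonneg _
  have hN : ((2 : ℕ) : ℝ) = 2 := by norm_num
  exact knit_arith hc.le hCOV0 hS0 hd0 hN hA h9 hB hC hcc1 hcc2

/-! ## §2 Stage B, inside form -/

/-- ★★★ **(a′) STAGE B, INSIDE FORM — `h7 ⊕ h8` AT THE MEMBER, `ℤ³` COARSE LETTERS** (NAMER WORD №15: first term = the INSIDE chart energy `Gφ_in`, not `‖D_Wφ‖²`): the blockwise Poincaré bound of the box mass with the coarse term converted to the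
`Ū`-differences of the comb averages `Q′_k φ♭` (px5's [I-5-conv]) plus `e²`-costs. -/
theorem h7h8_core_in {L : ℕ} (hL : 1 < L) (hF : F.L = L) (hnK : n ≤ K) {ε : ℝ} (he : 0 < ε) (he4 : ε ≤ min (6 * C0 3)⁻¹ (c2' 3 L / 4))
    (W : GaugeField (F.P K) 0 (Matrix.specialUnitaryGroup (Fin 2) ℂ)) (hW : RegPr F n K ε W)
    {CT : ℝ} (T : PBond (F.P K) (K - n) → (Matrix (Fin 2) (Fin 2) ℂ)ˣ) (hTU1 : ∀ c, T c ∈ U1 (Matrix (Fin 2) (Fin 2) ℂ))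
    (hclose : ∀ c : PBond (F.P K) (K - n),
      ‖(T c : Matrix (Fin 2) (Fin 2) ℂ) - ((holT (unitsField (toUField W)) (transl (basePt F n K) (blockBase ((F.P K).L ^ (K - n)) (tlift c.src)))
          (List.replicate ((F.P K).L ^ (K - n)) (c.dir, true)) : (Matrix (Fin 2) (Fin 2) ℂ)ˣ) : Matrix (Fin 2) (Fin 2) ℂ)‖ ≤ CT * ε)
    {z : Zd (F.P K).d} {Rf : ℤ} (hRN : 2 * Rf + 1 ≤ ((F.P K).sitesPerDir 0 : ℤ)) (lo : Zd (F.P K).d) (m : ℕ)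
    (hzlo : ∀ i, z i - Rf = ((F.L ^ (K - n) : ℕ) : ℤ) * lo i)
    (hzhi : ∀ i, z i + Rf = ((F.L ^ (K - n) : ℕ) : ℤ) * lo i + (((m + 1) * F.L ^ (K - n) - 1 : ℕ) : ℤ))
    (V : Zd (F.P K).d → Fin (F.P K).d → (Matrix (Fin 2) (Fin 2) ℂ)ˣ) (hV : ∀ w μ, V w μ = unitsField (toUField W) ⟨transl (basePt F n K) w, μ⟩)
    {α : ℝ} (hα : 0 ≤ α) (hP : B8Lemma1NonAbelian.PlaqSmall V (fun i => z i - Rf) (fun i => z i + Rf) α)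
    (φ : SiteL2K ℂ 3 (periodsT3 F K) c₀ W₂) (φZ : Zd (F.P K).d → Matrix (Fin 2) (Fin 2) ℂ)
    (hφZ : ∀ w ∈ box z Rf, (toL2S F K c₀).symm φ (transl (basePt F n K) w) = (eta F n K) • φZ w)
    (h0 : ∑ w ∈ box z Rf, conjR (axialFn V (fun i => z i - Rf) w) (φZ w) = 0) :
    c₀ * ∑ w ∈ box z Rf, ∑ j : Fin 2, ∑ k : Fin 2, ‖((toL2S F K c₀).symm φ (transl (basePt F n K) w)) j k‖ ^ 2
      ≤ 8 * (c₀ * ∑ w ∈ box z Rf, ∑ μ, (if w + unitVec μ ∈ box z Rf then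
            ∑ j : Fin 2, ∑ k : Fin 2, ‖(conjR (V w μ) (φZ (w + unitVec μ)) - φZ w) j k‖ ^ 2 else 0))
        + 32 * ((F.L : ℝ) ^ (K - n)) ^ 2 * (2 * ((F.P K).d : ℝ) * Rf * α) ^ 2 * ((F.P K).d : ℝ) * ‖φ‖ ^ 2
        + 32 * ((m : ℝ) * (m + 1) / 2) *
            (c₀ * ((((F.L ^ (K - n)) ^ (F.P K).d : ℕ) : ℝ)) *
              ∑ q ∈ ((Fintype.piFinset (fun i => Finset.Icc (lo i) (lo i + m))) ×ˢ (Finset.univ : Finset (Fin (F.P K).d))).filter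
                  (fun q => q.1 + e q.2 ∈ Fintype.piFinset (fun i => Finset.Icc (lo i) (lo i + m))),
                ‖conjR (pull T 0 q.1 q.2)
                    (QprimeIter (zdBlocking (F.P K).d (F.P K).L) (bgT (F.P K).L (pull (bgUnits F K W) (basePt F n K))) (K - n)
                      (fun x => (toL2S F K c₀).symm φ (transl (basePt F n K) x)) (q.1 + e q.2))
                  - QprimeIter (zdBlocking (F.P K).d (F.P K).L) (bgT (F.P K).L (pull (bgUnits F K W) (basePt F n K))) (K - n)
                      (fun x => (toL2S F K c₀).symm φ (transl (basePt F n K) x)) q.1‖ ^ 2)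
        + 64 * ((m : ℝ) * (m + 1) / 2) * ((F.P K).d : ℝ) *
            (((2 * CT + 48 * ((m + 1 : ℕ) : ℝ) + 29232) * ε) ^ 2 + ((29232 + 36 * ((m + 1 : ℕ) : ℝ)) * ε) ^ 2) * ‖φ‖ ^ 2 := by
  classical
  have hc : 0 < c₀ := Fact.out
  have hL0 : 0 < F.L := by have := F.hL.2; omega
  have hℓ : 1 ≤ F.L ^ (K - n) := Nat.one_le_pow _ _ hL0
  have hη : 0 < eta F n K := eta_pos F n K
  -- the pull-back connection IS `pull (bgUnits W) basePt`
  have hVeq : V = pull (bgUnits F K W) (basePt F n K) := funext fun w => funext fun μ => hV w μ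
  subst hVeq
  have hbox := tiled_eq_box_of F n K lo m hzlo hzhi
  -- stage A
  have hA := knitA_in F n K c₀ W (basePt F n K) hRN lo m hbox _ (fun w μ => rfl) hα hP φ φZ hφZ h0
  -- the currency identity and the conversion row (px5)
  have hY := sum_normSq_axialDiff_eq F n K c₀ (pull (bgUnits F K W) (basePt F n K)) (fun i => z i - Rf) lo m hzlo hzhi φ φZ hφZ
  have hC' : ∀ q ∈ ((Fintype.piFinset (fun i => Finset.Icc (lo i) (lo i + m))) ×ˢ (Finset.univ : Finset (Fin (F.P K).d))).filter
        (fun q => q.1 + e q.2 ∈ Fintype.piFinset (fun i => Finset.Icc (lo i) (lo i + m))),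
      (fun i => z i - Rf) ≤ blockBase ((F.P K).L ^ (K - n)) q.1 ∧
      (∀ x ∈ blockIter (F.P K).L (K - n) q.1, ∀ i, x i - (fun i => z i - Rf) i ≤ (((m + 1) * (F.P K).L ^ (K - n) : ℕ) : ℤ)) ∧
      (∀ x ∈ blockIter (F.P K).L (K - n) (q.1 + e q.2), ∀ i, x i - (fun i => z i - Rf) i ≤ (((m + 1) * (F.P K).L ^ (K - n) : ℕ) : ℤ)) := by
    intro q hq
    rw [Finset.mem_filter, Finset.mem_product] at hq
    obtain ⟨⟨hq1, -⟩, hq2⟩ := hq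
    have hℓ0 : (0 : ℤ) ≤ ((F.L ^ (K - n) : ℕ) : ℤ) := by positivity
    have hcast : (((m + 1) * (F.P K).L ^ (K - n) : ℕ) : ℤ) = ((m : ℤ) + 1) * ((F.L ^ (K - n) : ℕ) : ℤ) := by
      rw [show (F.P K).L = F.L from rfl]; push_cast; ring
    have hcast1 : ((F.L ^ (K - n) - 1 : ℕ) : ℤ) = ((F.L ^ (K - n) : ℕ) : ℤ) - 1 := by rw [Nat.cast_sub hℓ]; simp
    have height : ∀ b ∈ Fintype.piFinset (fun i => Finset.Icc (lo i) (lo i + m)),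
        ∀ x ∈ blockIter (F.P K).L (K - n) b, ∀ i, x i - (fun i => z i - Rf) i ≤ (((m + 1) * (F.P K).L ^ (K - n) : ℕ) : ℤ) := by
      intro b hb x hx i
      rw [blockIter_eq_blk] at hx
      have h1 := (Finset.mem_Icc.mp (Fintype.mem_piFinset.mp hx i)).2
      have h2 := (Finset.mem_Icc.mp (Fintype.mem_piFinset.mp hb i)).2
      have h3 : ((F.L ^ (K - n) : ℕ) : ℤ) * b i ≤ ((F.L ^ (K - n) : ℕ) : ℤ) * (lo i + m) := mul_le_mul_of_nonneg_left h2 hℓ0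
      show x i - (z i - Rf) ≤ _
      rw [hzlo i, hcast, hcast1] at *
      nlinarith
    refine ⟨fun i => ?_, height q.1 hq1, height (q.1 + e q.2) hq2⟩
    show z i - Rf ≤ (((F.P K).L ^ (K - n) : ℕ) : ℤ) * q.1 i
    rw [hzlo i, show (F.P K).L = F.L from rfl]
    exact mul_le_mul_of_nonneg_left (Finset.mem_Icc.mp (Fintype.mem_piFinset.mp hq1 i)).1 hℓ0
  have hconv := (sum_sq_grad_conv_of_regPr F n K hL hF hnK he he4 hW T hTU1 hclose (fun i => z i - Rf) (m + 1) _ hC'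
    (fun x => (toL2S F K c₀).symm φ (transl (basePt F n K) x))).2
  have hS1 := sum_C_tgt_le F n K c₀ lo m hzlo hzhi φ φZ hφZ
  have hS2 := sum_C_src_le F n K c₀ lo m hzlo hzhi φ φZ hφZ
  have hCrow := eta_sq_sum_opNorm_sq_le_norm_sq F n K c₀ (basePt F n K) hRN φ φZ hφZ (box z Rf) (Finset.Subset.refl _)
  have hω := weight_eq F n K
  have hℓd : (0 : ℝ) < ((((F.L ^ (K - n)) ^ (F.P K).d : ℕ) : ℝ)) := by positivity
  have hd0 : (0 : ℝ) ≤ ((F.P K).d : ℝ) := Nat.cast_nonneg _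
  have hcm : (0 : ℝ) ≤ (m : ℝ) * (m + 1) / 2 := by positivity
  exact knitB_arith hc.le hcm hℓd hd0 hA hY hω hconv hS1 hS2 hCrow

/-- ★★★ **(a′) `h7 ⊕ h8` AT THE MEMBER, INSIDE FORM (THE ROW OF RECORD after NAMER WORD №15)** — as ✓`h7h8_member` with the first term the INSIDE chart energy `Gφ_in = c₀Σ_{w∈Q}Σ_μ𝟙[w+e_μ∈Q]·hs(Ad(V w μ)φ_Z(w+e_μ) − φ_Z w)` (= (B8-member) (h1)'s `φ_Z`-letter, fed by ✓`patch_alpha_rows`' `Gφ_in ≤ N_T`), no `hD`. Original description: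
for the box `box z R_f` of the base chart `basePt` tiled by the `(m+1)^3` comb blocks `b ∈ lo + [0,m]^3` (`z − R_f = ℓ·lo`, `z + R_f = ℓ·lo + (m+1)ℓ − 1`), the local
potential `φ` of (B8-member) with chart function `φ_Z` (rows `hφZ`, `hD`, normalisation (0)), the box pull-back `V` with `PlaqSmall V (z−R_f) (z+R_f) α`, and any unit
coarse transporter `T` with the (B3c) rider:
`Φt ≤ 8·Gφ_in + 32ℓ²(2dR_fα)²d·‖φ‖² + 32·c_m·(c₀ℓ^d·Σ_{ĉ ∈ ι(C)}‖Ad(T ĉ)(Q′φ)(ĉ₊) − (Q′φ)(ĉ.src)‖²) + 64·c_m·d·(γ′² + γ²)·‖φ‖²`,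
`Φt := c₀Σ_{w ∈ box}hs(φ♭(basePt + w))`, `c_m = m(m+1)∕2`, `γ′ = (2CT + 48(m+1) + 29232)ε`, `γ = (29232 + 36(m+1))ε`, `Q′φ := QprimeCombL2 W φ`, `ι(C)` = the torus images
`⟨transl 0 b, μ⟩` of the inner coarse bonds of the cube (`8` is `R`- and `K`-free; with `α = e·η²` (P-box) the second term is `≤ 55296·R²·e²·‖φ‖²`).
[cite: Balaban1985Averaging, pp.24-25; Balaban1985BackgroundPropagators, (3.19) p.393, (3.100) p.413] -/
theorem h7h8_member_in {L : ℕ} (hL : 1 < L) (hF : F.L = L) (hnK : n ≤ K) {ε : ℝ} (he : 0 < ε) (he4 : ε ≤ min (6 * C0 3)⁻¹ (c2' 3 L / 4))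
    (W : GaugeField (F.P K) 0 (Matrix.specialUnitaryGroup (Fin 2) ℂ)) (hW : RegPr F n K ε W)
    {CT : ℝ} (T : PBond (F.P K) (K - n) → (Matrix (Fin 2) (Fin 2) ℂ)ˣ) (hTU1 : ∀ c, T c ∈ U1 (Matrix (Fin 2) (Fin 2) ℂ))
    (hclose : ∀ c : PBond (F.P K) (K - n),
      ‖(T c : Matrix (Fin 2) (Fin 2) ℂ) - ((holT (unitsField (toUField W)) (transl (basePt F n K) (blockBase ((F.P K).L ^ (K - n)) (tlift c.src)))
          (List.replicate ((F.P K).L ^ (K - n)) (c.dir, true)) : (Matrix (Fin 2) (Fin 2) ℂ)ˣ) : Matrix (Fin 2) (Fin 2) ℂ)‖ ≤ CT * ε)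
    {z : Zd (F.P K).d} {Rf : ℤ} (hRN : 2 * Rf + 1 ≤ ((F.P K).sitesPerDir 0 : ℤ)) (lo : Zd (F.P K).d) (m : ℕ)
    (hzlo : ∀ i, z i - Rf = ((F.L ^ (K - n) : ℕ) : ℤ) * lo i)
    (hzhi : ∀ i, z i + Rf = ((F.L ^ (K - n) : ℕ) : ℤ) * lo i + (((m + 1) * F.L ^ (K - n) - 1 : ℕ) : ℤ))
    (V : Zd (F.P K).d → Fin (F.P K).d → (Matrix (Fin 2) (Fin 2) ℂ)ˣ) (hV : ∀ w μ, V w μ = unitsField (toUField W) ⟨transl (basePt F n K) w, μ⟩)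
    {α : ℝ} (hα : 0 ≤ α) (hP : B8Lemma1NonAbelian.PlaqSmall V (fun i => z i - Rf) (fun i => z i + Rf) α)
    (φ : SiteL2K ℂ 3 (periodsT3 F K) c₀ W₂) (φZ : Zd (F.P K).d → Matrix (Fin 2) (Fin 2) ℂ)
    (hφZ : ∀ w ∈ box z Rf, (toL2S F K c₀).symm φ (transl (basePt F n K) w) = (eta F n K) • φZ w)
    (h0 : ∑ w ∈ box z Rf, conjR (axialFn V (fun i => z i - Rf) w) (φZ w) = 0) :
    c₀ * ∑ w ∈ box z Rf, ∑ j : Fin 2, ∑ k : Fin 2, ‖((toL2S F K c₀).symm φ (transl (basePt F n K) w)) j k‖ ^ 2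
      ≤ 8 * (c₀ * ∑ w ∈ box z Rf, ∑ μ, (if w + unitVec μ ∈ box z Rf then
            ∑ j : Fin 2, ∑ k : Fin 2, ‖(conjR (V w μ) (φZ (w + unitVec μ)) - φZ w) j k‖ ^ 2 else 0))
        + 32 * ((F.L : ℝ) ^ (K - n)) ^ 2 * (2 * ((F.P K).d : ℝ) * Rf * α) ^ 2 * ((F.P K).d : ℝ) * ‖φ‖ ^ 2
        + 32 * ((m : ℝ) * (m + 1) / 2) *
            (c₀ * ((((F.L ^ (K - n)) ^ (F.P K).d : ℕ) : ℝ)) *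
              ∑ ĉ ∈ (((Fintype.piFinset (fun i => Finset.Icc (lo i) (lo i + m))) ×ˢ (Finset.univ : Finset (Fin (F.P K).d))).filter
                  (fun q => q.1 + e q.2 ∈ Fintype.piFinset (fun i => Finset.Icc (lo i) (lo i + m)))).image
                  (fun q => (⟨transl (0 : Site (F.P K) (K - n)) q.1, q.2⟩ : PBond (F.P K) (K - n))),
                ‖conjR (T ĉ) (QprimeCombL2 F n K c₀ W φ (ĉ.src.shift ĉ.dir)) - QprimeCombL2 F n K c₀ W φ ĉ.src‖ ^ 2)
        + 64 * ((m : ℝ) * (m + 1) / 2) * ((F.P K).d : ℝ) *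
            (((2 * CT + 48 * ((m + 1 : ℕ) : ℝ) + 29232) * ε) ^ 2 + ((29232 + 36 * ((m + 1 : ℕ) : ℝ)) * ε) ^ 2) * ‖φ‖ ^ 2 := by
  have hd : 0 < (F.P K).d := by rw [T3Family.P_d]; norm_num
  have hm := succ_le_sitesPerDir_of F n K hnK hRN lo m ⟨0, hd⟩ (hzlo _) (hzhi _)
  rw [← sum_C_normSq_combDiff_eq F n K c₀ hnK W T lo m hm φ]
  exact h7h8_core_in F n K c₀ hL hF hnK he he4 W hW T hTU1 hclose hRN lo m hzlo hzhi V hV hα hP φ φZ hφZ h0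

end Summit.QuantumFields.YangMills.Theorems.Prop7TiledCubeMemberH7H8In
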